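import Mathlib
import Summits.Ventures.HodgeRepro.Tier4.Common.LocalCoordinatesConj
import Summits.Ventures.HodgeRepro.Tier4.Line4.D3CoeffInfOnly
import Summits.Ventures.HodgeRepro.Tier4.Line4.DefiniteCoeff
import Summits.Ventures.HodgeRepro.Tier4.Line4.DetTwist
import Summits.Ventures.HodgeRepro.Tier4.Line4.D3CoeffGeneral
import Summits.Ventures.HodgeRepro.Tier4.Line4.ArchProdCoeff

/-!
# Tier4/Line4/ArchProdInfOnly — the `infOnly` field of `IsArchCoeff` for the definite-place factors, the twist, the general
`w₀`-factors and the product witnesses: every one of them is a function of the archimedean coordinate only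

Blind re-derivation cell `pub-hodge-repro`, Tier 4 (README §9–§10), seat t4-L1-p5 (prover, gen 5; C-L4-ARCHPROD,
S15149 / S15216).  Target tree path `lean/Summits/Ventures/HodgeRepro/Tier4/Line4/ArchProdInfOnly.lean`.  On t4-L4-p1 g4's
`Line4/D3CoeffInfOnly` (p703420: **`locEntry'_ofInfPart : locEntry' w (GA.ofInfPart _ x) I J = locEntry' w x I J`** — the
`T′`-adapted coordinates at an infinite place read the archimedean component only) and the seat's `DefiniteCoeff`
(p703816), `DetTwist` (p704275), `D3CoeffGeneral`, `ArchProdCoeff`; no printed input.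

WHAT IS PROVED (kernel, no print): `defCoeff_ofInfPart`, `locMat'_ofInfPart`, `detTwist_ofInfPart`, `d3Gen_ofInfPart`,
`d3Gen'_ofInfPart`, `defCoeffProd_ofInfPart`, `archProd_ofInfPart` (from the `infOnly` law of the `w₀`-factor), and
**`archWitness_ofInfPart` / `archWitness'_ofInfPart`** — `∀ x, F x = F (GA.ofInfPart W x)`, the `infOnly` field of
`IsArchCoeff` VERBATIM (L1Class L285) for both product witnesses, with NO hypothesis.

STATUS OF THE (7a) WITNESS (`IsArchCoeffD`): `cont` ✓ · `infOnly` ✓ (this module) · `equiv` ✓ (all places, all displayed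
weights; ArchProdCoeff) · `decay` ✓ (one indefinite place; ArchProdCoeff) · `integrable` (modulo `hD3inf`, p701176) ·
`arch_ne` / `pseudo` / `pseudo'` DISPLAYED.  Nothing here says anything about the status of the Hodge conjecture for CM
abelian varieties, which is NOT proved (HC_CM is NOT proved by anyone in this repository).
-/

set_option autoImplicit false

noncomputable section

namespace Summit.Ventures.HodgeRepro.Tier4.Line4

open Summit.Ventures.HodgeRepro.Tier4.Common Summit.Ventures.HodgeRepro.Tier4.Line1 NumberField Matrix

open scoped ComplexConjugate

open scoped Classical

section InfOnly

variable {k : Type} [Field k] [NumberField k] (q : QuadData k) (a : Fin 4 → k)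
  (g g' : Matrix (Fin 4) (Fin 4) k) (hgg' : g * g' = 1) (hg'g : g' * g = 1)
  (hgΩ : g * (PlaneData.mixedRow q (a 0) (a 2)).Ω = (PlaneData.mixedRow q (a 0) (a 2)).Ω * g)
  (lam : k)
  (hiso : g * (PlaneData.mixedRow q (a 1) (a 3)).B * gᵀ = lam • (PlaneData.mixedRow q (a 0) (a 2)).B)
  (w : InfinitePlace k)

/-- **`infOnly` for `defCoeff`**: `defCoeff w p m x = defCoeff w p m (GA.ofInfPart _ x)`. -/
theorem defCoeff_ofInfPart (p m : ℤ)
    (x : GA ((PlaneData.mixedRow q (a 0) (a 2)).withTransportedTorus g g' hgg' hg'g hgΩ)) :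
    defCoeff q a g g' hgg' hg'g hgΩ lam hiso w p m x =
      defCoeff q a g g' hgg' hg'g hgΩ lam hiso w p m (GA.ofInfPart _ x) := by
  unfold defCoeff
  rw [locEntry'_ofInfPart q a g g' hgg' hg'g hgΩ lam hiso w x, locEntry'_ofInfPart q a g g' hgg' hg'g hgΩ lam hiso w x]

/-- `locMat' w (GA.ofInfPart _ x) = locMat' w x`. -/
theorem locMat'_ofInfPart (x : GA ((PlaneData.mixedRow q (a 0) (a 2)).withTransportedTorus g g' hgg' hg'g hgΩ)) :
    locMat' q a g g' hgg' hg'g hgΩ lam hiso w (GA.ofInfPart _ x) = locMat' q a g g' hgg' hg'g hgΩ lam hiso w x := by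
  ext I J
  rw [locMat'_apply, locMat'_apply, locEntry'_ofInfPart]

/-- **`infOnly` for `detTwist`**. -/
theorem detTwist_ofInfPart (c : ℤ)
    (x : GA ((PlaneData.mixedRow q (a 0) (a 2)).withTransportedTorus g g' hgg' hg'g hgΩ)) :
    detTwist q a g g' hgg' hg'g hgΩ lam hiso w c x =
      detTwist q a g g' hgg' hg'g hgΩ lam hiso w c (GA.ofInfPart _ x) := by
  unfold detTwist
  rw [locMat'_ofInfPart]

/-- **`infOnly` for `d3Gen`**. -/
theorem d3Gen_ofInfPart (m : ℤ)
    (x : GA ((PlaneData.mixedRow q (a 0) (a 2)).withTransportedTorus g g' hgg' hg'g hgΩ)) :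
    d3Gen q a g g' hgg' hg'g hgΩ lam hiso w m x = d3Gen q a g g' hgg' hg'g hgΩ lam hiso w m (GA.ofInfPart _ x) := by
  rw [d3Gen_apply, d3Gen_apply, ← D3coeff'_ofInfPart, ← detTwist_ofInfPart]

/-- **`infOnly` for `d3Gen'`**. -/
theorem d3Gen'_ofInfPart (p : ℤ)
    (x : GA ((PlaneData.mixedRow q (a 0) (a 2)).withTransportedTorus g g' hgg' hg'g hgΩ)) :
    d3Gen' q a g g' hgg' hg'g hgΩ lam hiso w p x = d3Gen' q a g g' hgg' hg'g hgΩ lam hiso w p (GA.ofInfPart _ x) := by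
  rw [d3Gen'_apply, d3Gen'_apply, ← D3coeff''_ofInfPart, ← detTwist_ofInfPart]

end InfOnly

section ProdInfOnly

variable {k : Type} [Field k] [NumberField k] (q : QuadData k) (a : Fin 4 → k)
  (g g' : Matrix (Fin 4) (Fin 4) k) (hgg' : g * g' = 1) (hg'g : g' * g = 1)
  (hgΩ : g * (PlaneData.mixedRow q (a 0) (a 2)).Ω = (PlaneData.mixedRow q (a 0) (a 2)).Ω * g)
  (lam : k)
  (hiso : g * (PlaneData.mixedRow q (a 1) (a 3)).B * gᵀ = lam • (PlaneData.mixedRow q (a 0) (a 2)).B)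
  (w₀ : InfinitePlace k) (eP' eM' : InfinitePlace k → ℤ)

/-- **`infOnly` for the definite product**. -/
theorem defCoeffProd_ofInfPart
    (x : GA ((PlaneData.mixedRow q (a 0) (a 2)).withTransportedTorus g g' hgg' hg'g hgΩ)) :
    defCoeffProd q a g g' hgg' hg'g hgΩ lam hiso w₀ eP' eM' x =
      defCoeffProd q a g g' hgg' hg'g hgΩ lam hiso w₀ eP' eM' (GA.ofInfPart _ x) := by
  unfold defCoeffProd
  exact Finset.prod_congr rfl fun w' _ => defCoeff_ofInfPart q a g g' hgg' hg'g hgΩ lam hiso w' _ _ x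

/-- **`infOnly` for `archProd f₀`** from the `infOnly` law of the `w₀`-factor. -/
theorem archProd_ofInfPart
    {f₀ : GA ((PlaneData.mixedRow q (a 0) (a 2)).withTransportedTorus g g' hgg' hg'g hgΩ) → ℂ}
    (hf : ∀ x, f₀ x = f₀ (GA.ofInfPart _ x))
    (x : GA ((PlaneData.mixedRow q (a 0) (a 2)).withTransportedTorus g g' hgg' hg'g hgΩ)) :
    archProd q a g g' hgg' hg'g hgΩ lam hiso w₀ eP' eM' f₀ x =
      archProd q a g g' hgg' hg'g hgΩ lam hiso w₀ eP' eM' f₀ (GA.ofInfPart _ x) := by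
  rw [archProd_apply, archProd_apply, ← hf, ← defCoeffProd_ofInfPart]

/-- **THE `infOnly` FIELD FOR `archWitness`**: `∀ x, archWitness x = archWitness (GA.ofInfPart _ x)`. -/
theorem archWitness_ofInfPart
    (x : GA ((PlaneData.mixedRow q (a 0) (a 2)).withTransportedTorus g g' hgg' hg'g hgΩ)) :
    archWitness q a g g' hgg' hg'g hgΩ lam hiso w₀ eP' eM' x =
      archWitness q a g g' hgg' hg'g hgΩ lam hiso w₀ eP' eM' (GA.ofInfPart _ x) :=
  archProd_ofInfPart q a g g' hgg' hg'g hgΩ lam hiso w₀ eP' eM'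
    (d3Gen_ofInfPart q a g g' hgg' hg'g hgΩ lam hiso w₀ (eM' w₀)) x

/-- **THE `infOnly` FIELD FOR `archWitness'`**: `∀ x, archWitness' x = archWitness' (GA.ofInfPart _ x)`. -/
theorem archWitness'_ofInfPart
    (x : GA ((PlaneData.mixedRow q (a 0) (a 2)).withTransportedTorus g g' hgg' hg'g hgΩ)) :
    archWitness' q a g g' hgg' hg'g hgΩ lam hiso w₀ eP' eM' x =
      archWitness' q a g g' hgg' hg'g hgΩ lam hiso w₀ eP' eM' (GA.ofInfPart _ x) :=
  archProd_ofInfPart q a g g' hgg' hg'g hgΩ lam hiso w₀ eP' eM'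
    (d3Gen'_ofInfPart q a g g' hgg' hg'g hgΩ lam hiso w₀ (eP' w₀)) x

end ProdInfOnly

end Summit.Ventures.HodgeRepro.Tier4.Line4

end
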